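import Summits.Ventures.HSemireg.WedgeHankelRecurrenceInertia
import Summits.Ventures.HSemireg.WedgeHankelRecurrenceDistinctRoots
import Literature.NumberTheory.Weil1964.RealWeilIndexSignature

/-!
# Venture HSemireg — INERTIA = SIGNS OF THE EIGENVALUES, READ ON `H_t(P′/P)`: by PROVED Literature `Weil1964/RealWeilIndexSignature` (Sylvester + spectral theorem) **`sigPos (vᵀAv) = #{i | λ_i > 0}`,
# `sigNeg (vᵀAv) = #{i | λ_i < 0}`** for every real symmetric `A`; applied to `H_t(P′/P) = hermiteMatrix P (t+1)` (N110's dictionary) this turns the tree's PROVED eigenvalue-count form of Hermite's theorem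
# (Literature `HermiteRankSignature.card_eigenvalues_hermiteMatrix`, BPR Thm. 4.57∕4.58 for `Q = 1`) into **`(sigPos, sigNeg)(vᵀ H_t(P′/P) v) = (#roots_ℝ(P) + #pairs, #pairs)`** — a second, independent route to the
# `Q = 1` case of the gen-33 signature leaves (N128∕N129 go through the real decomposition; this one through the spectral theorem)

HONEST FRAMING. Part of the Lean index of the computation cell `pub-hsemireg` (seat p10 gen 33, Sunday typer «UNIFORM-IN-n»).
LINEAR ALGEBRA OF QUADRATIC FORMS AND REAL SYMMETRIC MATRICES ONLY (Mathlib's `sigPos` ∕ `sigNeg`, `Matrix.IsHermitian.eigenvalues`, `Matrix.IsHermitian.spectral_theorem`, `Matrix.toQuadraticForm'`): no variety, no cohomology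
theory, no sheaf, no Ext group and no semiregularity map is constructed here; nothing here says that HC / HC_CM / HC_AV holds; no Literature fact is declared or used (the Literature theorems used are PROVED and imported).
SOURCE (classical): Sylvester's law of inertia + the spectral theorem (the eigenvalue definition of the signature, e.g. Laurent 2008 §2.4.4; BPR §4.3.1), PROVED in the tree as Literature
`NumberTheory/Weil1964/RealWeilIndexSignature.{equivalent_toQuadraticForm'_weightedSumSquares, sigPos_toQuadraticForm', sigNeg_toQuadraticForm'}` (Weil 1964 Chap. II n° 26) — IMPORTED AND USED, not restated.
DEDUP DISCLOSURE (`rg` of the whole tree): the general «sigPos = number of positive eigenvalues» is that Literature module (also, Coxeter-specifically, `CoxeterElementRealEigenvalue.sigPos_form_eq_card`);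
`HermiteRankSignature.card_eigenvalues_hermiteMatrix` is USED BY IMPORT (not restated) and N110 `hermiteMatrix_eq_hankelSq` is the dictionary.  FOREIGN-TREE DISCLOSURE (gate `dedup.foreign` advisory): `Summits/RiemannHypothesis/RiemannHypothesis/Theorems/HandoffInertiaCount.lean`
(cell rh-explicit) proves `sigNeg M.toQuadraticForm' = #{negative eigenvalues}` (`sigNeg_eq_card_eigenvalues_neg`) for real symmetric `M` by an orthonormal-eigenvector count; the subtype-cardinality `sigNeg`
statement below prints like it — cited; here it is a one-line re-count of the Literature `Weil1964` identity.

WHAT IS IN THE TREE.  N126 (`WedgeHankelRecurrenceInertia`): imports `QuadraticForm.Signature`.  N110 (`WedgeHankelRecurrenceDistinctRoots`): `hermiteMatrix_eq_hankelSq` (`hermiteMatrix P (t+1) = H_t(P′/P)`, `P` monic).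
Literature `HermiteRealRootedness` ∕ `HermiteRankSignature`: `hermiteMatrix`, `hermiteMatrix_isHermitian`, `card_eigenvalues_hermiteMatrix`.  PROVED Literature `QuadraticFormDeterminantCharTwo.toQuadraticForm'_apply`.
Literature `Weil1964/RealWeilIndexSignature`: `sigPos_toQuadraticForm'`, `sigNeg_toQuadraticForm'`.  Mathlib: `Matrix.IsHermitian.eigenvalues`, `Fintype.card_subtype`.
THIS FILE (namespace `Summit.Ventures.HSemireg.Wedge.HankelOuter` continued; PLAIN on N126 + N110 + Literature `RealWeilIndexSignature`; 0 definitions):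
* §721 `sigPos_toQuadraticForm'_eq_fintype_card_eigenvalues_pos` ∕ `sigNeg_toQuadraticForm'_eq_fintype_card_eigenvalues_neg` (the Literature identities re-counted as `Fintype.card` of a subtype, the shape of `HermiteRankSignature`).
* §722 `hankelSq_dualSeq_derivative_isHermitian`, **`sigPos_sigNeg_hankelSq_dualSeq_derivative_real_via_eigenvalues`** (`P` monic real, `deg P ≤ t + 1`: `sigPos H_t(P′/P) = #roots_ℝ(P) + #{z ∈ Zer(P,ℂ) | Im z > 0}` and
  `sigNeg = #{z | Im z > 0}`, from Literature's eigenvalue counts + §721 — stated as ONE conjunction so as not to shadow the gen-33 leaves' separate statements), `fintype_card_eigenvalues_congr`, `card_eigenvalues_hankelSq_dualSeq_derivative_real`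
  (the eigenvalue counts of `H_t(P′/P)` themselves), `sigPos_eq_sigNeg_add_card_roots_via_eigenvalues` (signature = `#roots_ℝ(P)` as `sigPos = sigNeg + #roots`).
Nothing Ext-side.  New names only.
-/

open Module Polynomial
open scoped Matrix Polynomial

namespace Summit.Ventures.HSemireg.Wedge.HankelOuter

open Summit.Ventures.HSemireg.Wedge Summit.Ventures.HSemireg.Wedge.Hankel

/-! ## §721. The inertia indices of a real symmetric matrix are the numbers of positive ∕ negative eigenvalues -/

section Spectral

variable {n : Type*} [Fintype n] [DecidableEq n]

/-- **`sigPos (vᵀAv) = #{i | λ_i > 0}` in subtype-cardinality form** — Sylvester's law through the spectral theorem is PROVED Literature `NumberTheory/Weil1964/RealWeilIndexSignature.sigPos_toQuadraticForm'`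
(`= (Finset.univ.filter fun i => 0 < λ_i).card`, from `equivalent_toQuadraticForm'_weightedSumSquares : vᵀSv ≅ Σ λ_i y_i²`); here only re-counted as `Fintype.card` of the subtype, the shape of Literature
`HermiteRankSignature`. [this file, §721; cite: Weil1964 Chap. II n° 26 as formalised in the tree] -/
theorem sigPos_toQuadraticForm'_eq_fintype_card_eigenvalues_pos {A : Matrix n n ℝ} (hA : A.IsHermitian) :
    sigPos A.toQuadraticForm' = Fintype.card {i // 0 < hA.eigenvalues i} := by
  rw [Literature.NumberTheory.Weil1964.sigPos_toQuadraticForm' hA, Fintype.card_subtype]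

/-- **`sigNeg (vᵀAv) = #{i | λ_i < 0}`**, subtype form (Literature `RealWeilIndexSignature.sigNeg_toQuadraticForm'` re-counted; the same sentence also stands, for its own purposes, in another summit's tree:
`Summit.RiemannHypothesis.RiemannHypothesis.Theorems.HandoffInertiaCount.sigNeg_eq_card_eigenvalues_neg` — cited, not importable here by convention). [this file, §721] -/
theorem sigNeg_toQuadraticForm'_eq_fintype_card_eigenvalues_neg {A : Matrix n n ℝ} (hA : A.IsHermitian) :
    sigNeg A.toQuadraticForm' = Fintype.card {i // hA.eigenvalues i < 0} := by
  rw [Literature.NumberTheory.Weil1964.sigNeg_toQuadraticForm' hA, Fintype.card_subtype]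

end Spectral

/-! ## §722. Hermite's theorem for `H_t(P′/P)`, `Q = 1`, through the eigenvalues (Literature `HermiteRankSignature` + N110 + §721) -/

/-- `H_t(P′/P)` is a real symmetric (`IsHermitian`) matrix — it is Literature's `hermiteMatrix P (t+1)` for monic `P`. [bookkeeping] -/
theorem hankelSq_dualSeq_derivative_isHermitian {P : ℝ[X]} (hP : P.Monic) (t : ℕ) : (hankelSq ℝ t (dualSeq ℝ P (derivative P))).IsHermitian := by
  rw [← hermiteMatrix_eq_hankelSq hP t]
  exact Literature.Algebra.Polynomial.hermiteMatrix_isHermitian P (t + 1)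

/-- Eigenvalue counts do not depend on how a symmetric matrix is written (transport along an equality of matrices). [bookkeeping] -/
theorem fintype_card_eigenvalues_congr {n : Type*} [Fintype n] [DecidableEq n] {A B : Matrix n n ℝ} (h : A = B) (hA : A.IsHermitian) (hB : B.IsHermitian) (p : ℝ → Prop) [DecidablePred p] :
    Fintype.card {i // p (hA.eigenvalues i)} = Fintype.card {i // p (hB.eigenvalues i)} := by
  subst h
  rfl

/-- **The eigenvalue counts of `H_t(P′/P)`: `#{λ_i > 0} = #roots_ℝ(P) + #{z ∈ Zer(P,ℂ) | Im z > 0}` and `#{λ_i < 0} = #{z | Im z > 0}`** (`P` monic real, `deg P ≤ t + 1`; Literature's BPR Thm. 4.57∕4.58 read on the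
lineage's Hankel matrix via N110). [this file, §722] -/
theorem card_eigenvalues_hankelSq_dualSeq_derivative_real {t : ℕ} {P : ℝ[X]} (hP : P.Monic) (hPd : P.natDegree ≤ t + 1) :
    Fintype.card {i // 0 < (hankelSq_dualSeq_derivative_isHermitian hP t).eigenvalues i} = P.roots.toFinset.card + ((P.aroots ℂ).toFinset.filter fun z => 0 < z.im).card
      ∧ Fintype.card {i // (hankelSq_dualSeq_derivative_isHermitian hP t).eigenvalues i < 0} = ((P.aroots ℂ).toFinset.filter fun z => 0 < z.im).card := by
  have h := Literature.Algebra.Polynomial.HermiteSignature.card_eigenvalues_hermiteMatrix P hPd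
  have hM : hankelSq ℝ t (dualSeq ℝ P (derivative P)) = Literature.Algebra.Polynomial.hermiteMatrix P (t + 1) := (hermiteMatrix_eq_hankelSq hP t).symm
  exact ⟨(fintype_card_eigenvalues_congr hM _ (Literature.Algebra.Polynomial.hermiteMatrix_isHermitian P (t + 1)) (fun x => 0 < x)).trans h.1,
    (fintype_card_eigenvalues_congr hM _ (Literature.Algebra.Polynomial.hermiteMatrix_isHermitian P (t + 1)) (fun x => x < 0)).trans h.2⟩

/-- **Hermite's theorem for `H_t(P′/P)` through the eigenvalues: `sigPos (vᵀ H_t(P′/P) v) = #roots_ℝ(P) + #{z ∈ Zer(P,ℂ) | Im z > 0}` and `sigNeg = #{z | Im z > 0}`** (`P` monic real, `deg P ≤ t + 1`) — §721 applied to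
Literature's eigenvalue counts; an independent cross-check of the `Q = 1` case of the real signature leaves of this generation (stated as one conjunction). [this file, §722] -/
theorem sigPos_sigNeg_hankelSq_dualSeq_derivative_real_via_eigenvalues {t : ℕ} {P : ℝ[X]} (hP : P.Monic) (hPd : P.natDegree ≤ t + 1) :
    sigPos (hankelSq ℝ t (dualSeq ℝ P (derivative P))).toQuadraticForm' = P.roots.toFinset.card + ((P.aroots ℂ).toFinset.filter fun z => 0 < z.im).card
      ∧ sigNeg (hankelSq ℝ t (dualSeq ℝ P (derivative P))).toQuadraticForm' = ((P.aroots ℂ).toFinset.filter fun z => 0 < z.im).card := by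
  obtain ⟨h1, h2⟩ := card_eigenvalues_hankelSq_dualSeq_derivative_real hP hPd
  exact ⟨(sigPos_toQuadraticForm'_eq_fintype_card_eigenvalues_pos (hankelSq_dualSeq_derivative_isHermitian hP t)).trans h1,
    (sigNeg_toQuadraticForm'_eq_fintype_card_eigenvalues_neg (hankelSq_dualSeq_derivative_isHermitian hP t)).trans h2⟩

/-- Consequently the SIGNATURE of `H_t(P′/P)` read through the eigenvalues is the number of distinct real roots (BPR Thm. 4.58): `sigPos − sigNeg = #roots_ℝ(P)`, as a natural-number identity
`sigPos = sigNeg + #roots_ℝ(P)`. [this file, §722] -/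
theorem sigPos_eq_sigNeg_add_card_roots_via_eigenvalues {t : ℕ} {P : ℝ[X]} (hP : P.Monic) (hPd : P.natDegree ≤ t + 1) :
    sigPos (hankelSq ℝ t (dualSeq ℝ P (derivative P))).toQuadraticForm' = sigNeg (hankelSq ℝ t (dualSeq ℝ P (derivative P))).toQuadraticForm' + P.roots.toFinset.card := by
  obtain ⟨h1, h2⟩ := sigPos_sigNeg_hankelSq_dualSeq_derivative_real_via_eigenvalues hP hPd
  rw [h1, h2, add_comm]

end Summit.Ventures.HSemireg.Wedge.HankelOuter
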